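import Literature.AlgebraicGeometry.Resolution.WeightedResolutionDatum
import Literature.AlgebraicGeometry.Resolution.CobordantBlowupFiltration

/-!
# The two extended Rees algebras of a filtration coincide

Support for crux `WeightedConstruction` (stmt-0571), line `support-first-weights-second`, stub
`stub_extRees_bridge`.

The datum file `WeightedResolutionDatum.lean` defines the extended Rees algebra of a sequence of
ideals `I : ℕ → Ideal A` by generators,
`extReesAlgebra I = A[t⁻¹, a tⁿ : n ≥ 1, a ∈ Iₙ] ⊆ A[t, t⁻¹]` (an `Algebra.adjoin`), while the
tree's cobordant blow-up theory (`CobordantBlowupFiltration.lean`) works with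
`IdealFiltration.extendedRees F` = the Laurent polynomials whose coefficient of `tⁿ`, `n ≥ 0`,
lies in `F.ideal n`. For a descending multiplicative filtration `F` (`J₀ = A`,
`J_m J_n ⊆ J_{m+n}`) the two subalgebras of `A[t, t⁻¹]` are equal:

* `≤`: the generators `t⁻¹` and `a tⁿ` (`a ∈ Jₙ`) satisfy the coefficient condition
  (`T_neg_one_mem_extendedRees`, `C_mul_T_mem_extendedRees_iff`) and `extendedRees` is a
  subalgebra, so `Algebra.adjoin_le` applies;
* `≥`: a Laurent polynomial is the finite sum of its monomials `(coeffₘ p) tᵐ`; for `m = n ≥ 1`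
  the monomial is a generator, for `m = 0` it is a constant (`J₀ = A`), and for `m = -k < 0` it is
  `C a * (t⁻¹)ᵏ`.

This is the same argument as `cobordantAlgebra_eq_extendedRees` (the special case of the weighted
filtration of a weighted centre).
-/

noncomputable section

open CategoryTheory CategoryTheory.Limits AlgebraicGeometry TopologicalSpace
open Literature.AlgebraicGeometry.Resolution
open scoped LaurentPolynomial

set_option linter.dupNamespace false -- mandated namespace of this single-conjunct summit

namespace Summit.ResolutionOfSingularities.ResolutionOfSingularities.Theorems

/-- `t⁻ᵏ = (t⁻¹)ᵏ` lies in the extended Rees algebra `A[t⁻¹, Iₙ tⁿ]` of any sequence of ideals.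
[folklore] -/
theorem extReesAlgebra_T_neg_natCast_mem {A : Type*} [CommRing A] (I : ℕ → Ideal A) (k : ℕ) :
    (LaurentPolynomial.T (-(k : ℤ)) : A[T;T⁻¹]) ∈ extReesAlgebra I := by
  have h : (LaurentPolynomial.T (-(k : ℤ)) : A[T;T⁻¹]) = LaurentPolynomial.T (-1) ^ k := by
    rw [LaurentPolynomial.T_pow, mul_neg_one]
  rw [h]
  exact pow_mem (extReesAlgebra.tInv I).2 k

/-- `a t⁻ᵏ` lies in the extended Rees algebra `A[t⁻¹, Iₙ tⁿ]` of any sequence of ideals: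
`A[t⁻¹] ⊆ A[t⁻¹, Iₙ tⁿ]`. [folklore] -/
theorem extReesAlgebra_C_mul_T_neg_natCast_mem {A : Type*} [CommRing A] (I : ℕ → Ideal A)
    (a : A) (k : ℕ) :
    LaurentPolynomial.C a * LaurentPolynomial.T (-(k : ℤ)) ∈ extReesAlgebra I :=
  mul_mem (by rw [LaurentPolynomial.C_eq_algebraMap]; exact Subalgebra.algebraMap_mem _ a)
    (extReesAlgebra_T_neg_natCast_mem I k)

/-- **The bridge `A[t⁻¹, Jₙ tⁿ] = ⊕ₙ Jₙ tⁿ ⊕ A[t⁻¹]`**: for a descending multiplicative filtration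
`F` of ideals of `A`, the datum file's extended Rees algebra (the `A`-subalgebra of `A[t, t⁻¹]`
generated by `t⁻¹` and the `a tⁿ`, `n ≥ 1`, `a ∈ Jₙ`) equals the tree's
`IdealFiltration.extendedRees F` (Laurent polynomials whose coefficient of `tⁿ`, `n ≥ 0`, lies
in `Jₙ`). `≤`: the generators satisfy the coefficient condition and `extendedRees` is a
subalgebra; `≥`: every Laurent polynomial is the sum of its monomials, each of which is a
generator (`n ≥ 1`), a constant (`n = 0`, `J₀ = A`) or `a (t⁻¹)ᵏ` (`n = -k < 0`). [folklore] -/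
theorem stub_extRees_bridge : ∀ (A : Type) [CommRing A] (F : IdealFiltration A),
    extReesAlgebra F.ideal = F.extendedRees := by
  intro A _ F
  apply le_antisymm
  · refine Algebra.adjoin_le ?_
    rintro _ (rfl | ⟨n, _, a, ha, rfl⟩)
    · exact F.T_neg_one_mem_extendedRees
    · exact F.C_mul_T_mem_extendedRees_iff.mpr ha
  · intro p hp
    rw [← AddMonoidAlgebra.sum_coeff_single p, Finsupp.sum]
    refine Subalgebra.sum_mem _ fun m _ => ?_
    rw [LaurentPolynomial.single_eq_C_mul_T]
    rcases lt_or_ge m 0 with hm | hm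
    · obtain ⟨k, hk⟩ := Int.exists_eq_neg_ofNat hm.le
      rw [hk]
      exact extReesAlgebra_C_mul_T_neg_natCast_mem F.ideal _ k
    · obtain ⟨n, rfl⟩ := Int.eq_ofNat_of_zero_le hm
      rcases Nat.eq_zero_or_pos n with rfl | hpos
      · rw [Nat.cast_zero, LaurentPolynomial.T_zero, mul_one, LaurentPolynomial.C_eq_algebraMap]
        exact Subalgebra.algebraMap_mem _ _
      · exact extReesAlgebra.C_mul_T_mem F.ideal hpos ((F.mem_extendedRees_iff.mp hp) n)

end Summit.ResolutionOfSingularities.ResolutionOfSingularities.Theorems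

end
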